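import Summits.BirchSwinnertonDyer.BirchSwinnertonDyer.Theorems.AlignedTransportAtTwoMainConjectureOfRankZeroBSDAtTwoCubicRankDoorModelsRungZero
import Summits.BirchSwinnertonDyer.BirchSwinnertonDyer.Theorems.AlignedTransportAtTwoMainConjectureOfRankZeroBSDAtTwoCubicOffStratumFukudaIndexRow2045b1
import HarnessLib

/-!
# Route `AlignedTransportAtTwo`, crux C2 `MainConjectureOfRankZeroBSDAtTwo` (stmt-22298), line `birth` — THE RANK / CLASS-NUMBER DOORS ON CONCRETE LAYER
# MODELS AT EVERY RUNG `m ≥ 0`, UNIFORM IN THE STRATUM (`Δ_W < 0`, every `Δ_min mod 8`): the per-curve certificate of C2 is ONE equality of 2-ranks (or of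
# 2-parts of class numbers) of two EXPLICIT number fields `L ⊆ L'` of degrees `3·2^m`, `3·2^{m+1}`; at the rung `0`, `L = ℚ(β)` and `L' = ℚ(β)(√2)`

HONEST FRAMING (cell `bsd-f1-sign2`, WIDTH-5 attach seat `bsd-line-att-p4` g26, lineage att-p4 = route-ledger lane; `--supports stmt-BirchSwinnertonDyer-22298
--as helper`). THEOREMS ONLY (no `def`, no named fact, no `sorry`, no instance). BSD is NOT proved; C2 is NOT closed; its verdict «blocked-on
`Rank1Residual.GreenbergMuConjectureIrreducible`» is untouched; every door / row is CONDITIONAL on the displayed PRINT named facts {Kato 17.4 (1)(2) at `2`,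
Greenberg 4.1, period unit, modularity, GZK (+ Creutz–Miller for the row)}, the registered stub MuIneqʳ (verbatim) and ONE displayed per-curve certificate (a finite
class-group computation NOT performed here). No new mathematics: att-p5 g28's abstract-layer doors at ANY pair `(n, n+1)`, `n ≥ 0`, on EVERY stratum
(`…CubicOffStratumFukudaIndexDoors.mazurMainConjecture_two_of_muIneqRel_of_classGroupPRank_succ_eq` / `…_of_classNumberPExp_succ_eq`: Fukuda's index is `0` for the
cubic `2`-torsion field of every good-ordinary curve with `E(ℚ)[2] = 0`) read on att-p4 g25's concrete layer MODELS (`…CubicRankDoorModels.forall_classGroupPRank_succ_eq_of_layer_models`: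
`ℚ(β)_m ≃ₐ L` for every degree-`2^m` extension `L ⊇ ℚ(β)` with a root of `Ψ_m`, bsd-2adic w2 GEN 11 `nonempty_algEquiv_layer_of_iterate_root`), with `hμan` discharged
by the tree theorem `AnalyticMuTwo.red_ne_zero_of_isEvenBranchLiftAtTwo_of_forall_not_hasRationalTwoTorsionX`.

WHY. g25's plain models door (`…CubicRankDoorModels`, p757810) carries `1 ≤ m`; its rung-`0` models door (`…CubicRankDoorModelsRungZero`, p758570) carries the Kilford binder
`Δ_min ≡ 1 (mod 8)`; g28's uniform doors (p757752) are stated on the ABSTRACT layers `κP.layer n`. This file closes the square: models × every rung × every stratum,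
in both currencies a -data seat can compute (`bnfinit(...).cyc` 2-ranks; `bnfinit(...).no` class numbers).

* §1 CLASS NUMBERS READ ON A MODEL: `classNumberPExp_eq_of_ringEquiv` (`e_n(κ) = ord₂ h(L)` along `K_n ≃+* L`), `classNumberPExp_eq_of_iterate_root`,
  `forall_classNumberPExp_succ_eq_of_layer_models` (cubic `K`; models `L`, `L'` of degrees `2^m`, `2^{m+1}` with roots of `Ψ_m`, `Ψ_{m+1}` and `ord₂ h(L') = ord₂ h(L)`
  ⟹ `e_{m+1}(κ) = e_m(κ)` for every cyclotomic `κ`), `forall_classNumberPExp_one_eq_zero_of_layerOne_model` (rung `0`: `L = K`).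
* §2 **THE UNIFORM MODELS DOORS** (`Δ_W < 0`, ANY `m ≥ 0`, ANY `Δ_min mod 8`, `hμan`-free): `mazurMainConjecture_two_of_muIneqRel_of_classGroup_layer_models_anyRung`
  (**`rank₂ Cl(L') = rank₂ Cl(L)`** ⟹ `MC₂(W)`) and `mazurMainConjecture_two_of_muIneqRel_of_classNumber_layer_models_anyRung` (**`ord₂ h(L') = ord₂ h(L)`** ⟹ `MC₂(W)`).
* §3 **THE RUNG `0` ON MODELS, NO STRATUM BINDER**: `L = ℚ(β)` itself, `L'` ANY quadratic extension of `ℚ(β)` with `θ² = 2`: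
  `mazurMainConjecture_two_of_muIneqRel_of_classGroup_rungZero_models` (`rank₂ Cl(L') = rank₂ Cl(ℚ(β))`), `…_of_classNumber_rungZero_models`
  (`ord₂ h(L') = ord₂ h(ℚ(β))`) — p758570 §2 with `h8 : Δ_min % 8 = 1` DELETED.
* §4 ROW `2045b1` (THE off-stratum seed, `Δ_min ≡ 3 (mod 8)`, `N = 2045 < 5000`) AT THE RUNG `0` ON MODELS, both currencies, `hμan`-free:
  `mazurMainConjecture_two_2045b1_of_classGroup_rungZero_models`, `mazurMainConjecture_two_2045b1_of_classNumber_rungZero_models` — PRINT⁵ + Creutz–Miller + MuIneqʳ +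
  displayed {`r_an(2045b1) = 0`; ONE quadratic extension `L' ∋ √2` of `ℚ(u)`, `u³ − 3u² − 87520u − 55211200 = 0` (i.e. `β = u/…` a root of the `2`-division cubic
  `4x³ − 3x² − 21880x − 3450700`), with `rank₂ Cl(L') = rank₂ Cl(ℚ(u))` resp. `ord₂ h(L') = ord₂ h(ℚ(u))`} ⟹ `MC₂(2045b1)`. DATA ASK (-data): `bnfinit` of `ℚ(u)` and
  `ℚ(u, √2)` — the cheapest certificate of the cubic road for this seed (degrees `3` and `6`).

PARTITION (D-0171): none moved (certificates displayed, not computed). Beyond-print theorem: no ([Fukuda1994] Thm. 1, [Washington1997] §13.1, bookkeeping).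
BSD is NOT proved; C2 neither proved nor refuted.

References: [Fukuda1994] Thm. 1 (1)(2), p. 264; [Washington1997] §13.1 (`K_n = Kℚ_n`), Lemma 13.3; [Lang1990] Ch. 13 §4 Lemma 4.1; [Kato2004Asterisque]
Thm. 17.4 (1)(2) (p. 273); [GreenbergLNM1716] Thm. 4.1 (p. 102), Conj. 1.11 (p. 58); [CreutzMiller2012] Thm. 1.1; [CremonaAlgorithms1997] Table 1 (`2045b1`);
tree p757752 (g28 doors), p757810 / p758570 (g25 models), bsd-2adic w2 GEN 11 (`NarrowFukudaCertificateLayerPolynomialModels`).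
-/

set_option linter.dupNamespace false
set_option autoImplicit false

noncomputable section

open scoped MatrixGroups ModularForm NumberField Classical
open CongruenceSubgroup WeierstrassCurve Polynomial NumberField Module Field
open Literature.NumberTheory.EllipticCurves Literature.NumberTheory.EllipticCurves.ModularForms
open Literature.NumberTheory.EllipticCurves.Greenberg1999 Literature.NumberTheory.EllipticCurves.Module
open Literature.NumberTheory.EllipticCurves.Rank1Residual Literature.NumberTheory.EllipticCurves.Rank1Residual.Typed
open Literature.NumberTheory.GaloisRepresentations Literature.NumberTheory.IwasawaTheory
open Summit.BirchSwinnertonDyer.Rank1Residual Summit.BirchSwinnertonDyer.Rank1Residual.F1Sign2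
open Summit.BirchSwinnertonDyer.Rank1Residual.X1.MuLambda Summit.BirchSwinnertonDyer.Rank1Residual.X5
open Summit.BirchSwinnertonDyer.BirchSwinnertonDyer.Theorems.Rank1ResidualX1Defs
open Summit.BirchSwinnertonDyer.BirchSwinnertonDyer.Theses.AlignedTransportAtTwo
open Summit.BirchSwinnertonDyer.BirchSwinnertonDyer.Theorems.AlignedTransportAtTwoCubicNarrowRankDoor
  (finrank_adjoin_eq_three_of_forall_not_hasRationalTwoTorsionX)
open Summit.BirchSwinnertonDyer.BirchSwinnertonDyer.Theorems.AlignedTransportAtTwoCubicRankDoorModels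
  (forall_classGroupPRank_succ_eq_of_layer_models)
open Summit.BirchSwinnertonDyer.BirchSwinnertonDyer.Theorems.AlignedTransportAtTwoCubicRankDoorModelsRungZero
  (forall_classGroupPRank_one_eq_zero_of_layerOne_model)
open Summit.BirchSwinnertonDyer.BirchSwinnertonDyer.Theorems.AlignedTransportAtTwoCubicOffStratumFukudaIndexDoors
  (mazurMainConjecture_two_of_muIneqRel_of_classGroupPRank_succ_eq mazurMainConjecture_two_of_muIneqRel_of_classNumberPExp_succ_eq)
open Summit.BirchSwinnertonDyer.BirchSwinnertonDyer.Theorems.TowerClass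
open Summit.BirchSwinnertonDyer.BirchSwinnertonDyer.Theorems.AlignedTransportAtTwoOffStratumRow2045b
open Summit.BirchSwinnertonDyer.BirchSwinnertonDyer.Theorems.AlignedTransportAtTwoTwistFamilySmallSeeds
open Summit.BirchSwinnertonDyer.BirchSwinnertonDyer.Theorems (AnalyticMuTwo.red_ne_zero_of_isEvenBranchLiftAtTwo_of_forall_not_hasRationalTwoTorsionX)

namespace Summit.BirchSwinnertonDyer.BirchSwinnertonDyer.Theorems.AlignedTransportAtTwoCubicRankDoorModelsAnyRung

/-! ## §1 Class numbers read on a model -/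

/-- **`e_n(κ) = ord₂ h(L)` read on a model**: along any ring isomorphism `K_n ≃+* L` the `2`-part of the class number of the layer is that of `L`
(`Cl` is functorial in ring isomorphisms, Mathlib `ClassGroup.mulEquiv`). [cite: Fukuda1994, Thm. 1 (1), p. 264 (`|A_n|`)] [cite: Lang1990, Ch. 5 §1] -/
theorem classNumberPExp_eq_of_ringEquiv {K : Type} [Field K] [NumberField K] (κ : ZpExtension K 2) (n : ℕ)
    {L : Type*} [Field L] [NumberField L] (e : ↥(κ.layer n) ≃+* L) :
    classNumberPExp κ n = padicValNat 2 (Nat.card (ClassGroup (𝓞 L))) := by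
  rw [classNumberPExp_def]
  exact congrArg _ (Nat.card_congr (ClassGroup.mulEquiv (RingOfIntegers.mapRingEquiv e)).toEquiv)

/-- **`e_n(κ) = ord₂ h(L)` for every degree-`2ⁿ` extension `L ⊇ K` with a root of `Ψ_n`** (`[K:ℚ]` odd, `κ` cyclotomic: `K_n ≃ₐ[K] L` by bsd-2adic's
`nonempty_algEquiv_layer_of_iterate_root`). [cite: Washington1997, §13.1 (`K_n = Kℚ_n`, `[K_n : K] = 2ⁿ`)] [cite: Fukuda1994, Thm. 1 (1), p. 264] -/
theorem classNumberPExp_eq_of_iterate_root {K : Type} [Field K] [NumberField K] (hodd : Odd (Module.finrank ℚ K))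
    (κ : ZpExtension K 2) (hκ : κ.IsCyclotomic) (L : Type*) [Field L] [NumberField L] [Algebra K L] {n : ℕ}
    (hL : Module.finrank K L = 2 ^ n) (θ : L) (hθ : (fun x : L => x ^ 2 - 2)^[n] θ = 0) :
    classNumberPExp κ n = padicValNat 2 (Nat.card (ClassGroup (𝓞 L))) := by
  haveI : FiniteDimensional K L := Module.Finite.of_restrictScalars_finite ℚ K L
  obtain ⟨e⟩ := nonempty_algEquiv_layer_of_iterate_root hodd κ hκ L hL θ hθ
  exact classNumberPExp_eq_of_ringEquiv κ n e.toRingEquiv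

/-- **The class-number rung on models** (cubic `K`): `L ⊇ K` of degree `2^m` with a root of `Ψ_m`, `L' ⊇ K` of degree `2^{m+1}` with a root of `Ψ_{m+1}`
and `ord₂ h(L') = ord₂ h(L)` give `e_{m+1}(κ) = e_m(κ)` for EVERY cyclotomic `ℤ₂`-extension `κ` of `K`. [cite: Washington1997, §13.1]
[cite: Fukuda1994, Thm. 1 (1), p. 264] -/
theorem forall_classNumberPExp_succ_eq_of_layer_models {K : Type} [Field K] [NumberField K] (h3 : Module.finrank ℚ K = 3) (m : ℕ)
    (L : Type*) [Field L] [NumberField L] [Algebra K L] (hL : Module.finrank K L = 2 ^ m) (θ : L)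
    (hθ : (fun x : L => x ^ 2 - 2)^[m] θ = 0)
    (L' : Type*) [Field L'] [NumberField L'] [Algebra K L'] (hL' : Module.finrank K L' = 2 ^ (m + 1)) (θ' : L')
    (hθ' : (fun x : L' => x ^ 2 - 2)^[m + 1] θ' = 0)
    (he : padicValNat 2 (Nat.card (ClassGroup (𝓞 L'))) = padicValNat 2 (Nat.card (ClassGroup (𝓞 L)))) :
    ∀ κ : ZpExtension K 2, κ.IsCyclotomic → classNumberPExp κ (m + 1) = classNumberPExp κ m := by
  have hodd : Odd (Module.finrank ℚ K) := by rw [h3]; decide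
  intro κ hκ
  rw [classNumberPExp_eq_of_iterate_root hodd κ hκ L' hL' θ' hθ', classNumberPExp_eq_of_iterate_root hodd κ hκ L hL θ hθ, he]

/-- **The class-number rung `(0, 1)` on models** (cubic `K`): a quadratic extension `L' ⊇ K` containing `θ` with `θ² = 2` and `ord₂ h(L') = ord₂ h(K)` give
`e_1(κ) = e_0(κ)` for every cyclotomic `κ` (layer-`0` model `K` itself with `θ₀ = 0`). [cite: Washington1997, §13.1 (`K_0 = K`, `K_1 = K(√2)`)]
[cite: Fukuda1994, Thm. 1 (1), p. 264] -/
theorem forall_classNumberPExp_one_eq_zero_of_layerOne_model {K : Type} [Field K] [NumberField K] (h3 : Module.finrank ℚ K = 3)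
    (L' : Type*) [Field L'] [NumberField L'] [Algebra K L'] (hL' : Module.finrank K L' = 2) (θ : L') (hθ : θ ^ 2 = 2)
    (he : padicValNat 2 (Nat.card (ClassGroup (𝓞 L'))) = padicValNat 2 (Nat.card (ClassGroup (𝓞 K)))) :
    ∀ κ : ZpExtension K 2, κ.IsCyclotomic → classNumberPExp κ 1 = classNumberPExp κ 0 :=
  forall_classNumberPExp_succ_eq_of_layer_models h3 0 K (by rw [Module.finrank_self]; rfl) (0 : K)
    (Function.iterate_zero_apply _ _) L' (by rw [hL']; rfl) θ
    (by show θ ^ 2 - 2 = 0; rw [hθ, sub_self]) he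

/-! ## §2 The uniform models doors: every rung `m ≥ 0`, every stratum (`Δ_W < 0`, `hμan`-free) -/

section Doors

variable (W : WeierstrassCurve ℚ) [W.IsElliptic] [W.IsGloballyMinimal]

/-- **THE UNIFORM RANK DOOR ON MODELS (`Δ_W < 0`, ANY rung `m ≥ 0`, ANY `Δ_min mod 8`).** PRINT⁵ {Kato 17.4 (1)(2) at `2`, Greenberg 4.1, period unit,
modularity, GZK} + MuIneqʳ (verbatim) + cell hypotheses (good ordinary at `2`, no rational `2`-torsion abscissa, `Δ_W < 0`, `r_an = 0`, `BSD₂(W)`) + `β` a root of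
the `2`-division cubic + number fields `L ⊇ ℚ(β)` of degree `2^m` with a root of `Ψ_m` and `L' ⊇ ℚ(β)` of degree `2^{m+1}` with a root of `Ψ_{m+1}` with
**`rank₂ Cl(L') = rank₂ Cl(L)`** ⟹ `MC₂(W)`. No `1 ≤ m` (g25 p757810), no `Δ_min ≡ 1 (mod 8)` (g25 p758570), no `hμan`: Fukuda's index is `0` on every stratum
(att-p5 g28). CONDITIONAL; nothing closed; BSD is NOT proved. [cite: Fukuda1994, Thm. 1 (2), p. 264] [cite: Washington1997, §13.1 and Lemma 13.3]
[cite: Kato2004Asterisque, Thm. 17.4 (1)(2) (p. 273)] [cite: GreenbergLNM1716, Thm. 4.1 (p. 102) and Conj. 1.11 (p. 58)] -/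
theorem mazurMainConjecture_two_of_muIneqRel_of_classGroup_layer_models_anyRung
    (h17 : ∀ [NeZero (W.conductorNorm ℤ)] (f : CuspForm (Gamma0 (W.conductorNorm ℤ)) 2),
      kato_divisibility_allPrimes W 2 (f := f))
    (hGr : Greenberg1999.thm41_charValue_rankZero_anyPrime)
    (hper : realPeriodRat_eq_unit_mul_plusPeriod_two) (hmod : nonempty_modularParametrizationData)
    (hGZK : rank_eq_analyticRank_of_analyticRank_le_one)
    (hI : ∀ (W : WeierstrassCurve ℚ) [W.IsElliptic] [W.IsGloballyMinimal], IsOrdinaryAt W 2 →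
      (∀ x : ℚ, ¬ HasRationalTwoTorsionX W x) →
      ∀ (κ : ZpExtension ℚ 2) (γ : Field.absoluteGaloisGroup ℚ), κ.IsCyclotomic →
      κ.IsTopGenerator γ → IsCyclotomicVariable 2 γ →
      ∀ ⦃N : ℕ⦄ [NeZero N] (f : CuspForm (Gamma0 N) 2), IsNewformOf W f →
      ∀ Gp : IwasawaAlgebra 2, iwasawaToPowerSeries 2 Gp = padicLFunction f (unitRoot W 2 : ℚ_[2]) →
      ∀ (D : W.SelmerDualData κ γ) (Yr : W.FineSelmerDualDataRelaxedInf κ γ),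
        lengthAt (IwasawaAlgebra 2) D.X ⟨IwasawaAlgebra.augIdealP 2, IwasawaAlgebra.isPrime_augIdealP_holds 2⟩ ≤
          lengthAt (IwasawaAlgebra 2) (IwasawaAlgebra 2 ⧸ Ideal.span {Gp})
              ⟨IwasawaAlgebra.augIdealP 2, IwasawaAlgebra.isPrime_augIdealP_holds 2⟩ +
            lengthAt (IwasawaAlgebra 2) Yr.X ⟨IwasawaAlgebra.augIdealP 2, IwasawaAlgebra.isPrime_augIdealP_holds 2⟩)
    (hord : IsOrdinaryAt W 2) (ht : ∀ x : ℚ, ¬ HasRationalTwoTorsionX W x) (hΔ : W.Δ < 0) (hr : W.analyticRank = 0) (hbsd : BSDp W 2)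
    {β : AlgebraicClosure ℚ} (hβ : aeval β W.twoTorsionPolynomial.toPoly = 0) {m : ℕ}
    (L : Type) [Field L] [NumberField L] [Algebra ↥(IntermediateField.adjoin ℚ ({β} : Set (AlgebraicClosure ℚ))) L]
    (hL : Module.finrank ↥(IntermediateField.adjoin ℚ ({β} : Set (AlgebraicClosure ℚ))) L = 2 ^ m) (θ : L)
    (hθ : (fun x : L => x ^ 2 - 2)^[m] θ = 0)
    (L' : Type) [Field L'] [NumberField L'] [Algebra ↥(IntermediateField.adjoin ℚ ({β} : Set (AlgebraicClosure ℚ))) L']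
    (hL' : Module.finrank ↥(IntermediateField.adjoin ℚ ({β} : Set (AlgebraicClosure ℚ))) L' = 2 ^ (m + 1)) (θ' : L')
    (hθ' : (fun x : L' => x ^ 2 - 2)^[m + 1] θ' = 0)
    (hrank : padicValNat 2 (Nat.card (ClassGroup (𝓞 L') ⧸ (powMonoidHom 2 : ClassGroup (𝓞 L') →* ClassGroup (𝓞 L')).range)) =
      padicValNat 2 (Nat.card (ClassGroup (𝓞 L) ⧸ (powMonoidHom 2 : ClassGroup (𝓞 L) →* ClassGroup (𝓞 L)).range))) :
    MazurMainConjecture W 2 := by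
  haveI : FiniteDimensional ℚ ↥(IntermediateField.adjoin ℚ ({β} : Set (AlgebraicClosure ℚ))) :=
    IntermediateField.adjoin.finiteDimensional ((AlgebraicClosure.isAlgebraic ℚ).isAlgebraic β).isIntegral
  haveI : NumberField ↥(IntermediateField.adjoin ℚ ({β} : Set (AlgebraicClosure ℚ))) := NumberField.mk
  have h3 := finrank_adjoin_eq_three_of_forall_not_hasRationalTwoTorsionX W ht hβ
  exact mazurMainConjecture_two_of_muIneqRel_of_classGroupPRank_succ_eq W h17 hGr hper hmod hGZK hI hord ht hΔ hr
    (AnalyticMuTwo.red_ne_zero_of_isEvenBranchLiftAtTwo_of_forall_not_hasRationalTwoTorsionX W hord ht) hbsd hβ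
    fun κP hκP => ⟨m, forall_classGroupPRank_succ_eq_of_layer_models h3 m L hL θ hθ L' hL' θ' hθ' hrank κP hκP⟩

/-- **THE UNIFORM CLASS-NUMBER DOOR ON MODELS (`Δ_W < 0`, ANY rung `m ≥ 0`, ANY `Δ_min mod 8`).** The same with **`ord₂ h(L') = ord₂ h(L)`** (Fukuda Thm. 1 (1)
at the pair `(m, m+1)`; the index is `0`). CONDITIONAL; nothing closed; BSD is NOT proved. [cite: Fukuda1994, Thm. 1 (1), p. 264] [cite: Washington1997, §13.1]
[cite: Kato2004Asterisque, Thm. 17.4 (1)(2) (p. 273)] [cite: GreenbergLNM1716, Thm. 4.1 (p. 102) and Conj. 1.11 (p. 58)] -/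
theorem mazurMainConjecture_two_of_muIneqRel_of_classNumber_layer_models_anyRung
    (h17 : ∀ [NeZero (W.conductorNorm ℤ)] (f : CuspForm (Gamma0 (W.conductorNorm ℤ)) 2),
      kato_divisibility_allPrimes W 2 (f := f))
    (hGr : Greenberg1999.thm41_charValue_rankZero_anyPrime)
    (hper : realPeriodRat_eq_unit_mul_plusPeriod_two) (hmod : nonempty_modularParametrizationData)
    (hGZK : rank_eq_analyticRank_of_analyticRank_le_one)
    (hI : ∀ (W : WeierstrassCurve ℚ) [W.IsElliptic] [W.IsGloballyMinimal], IsOrdinaryAt W 2 →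
      (∀ x : ℚ, ¬ HasRationalTwoTorsionX W x) →
      ∀ (κ : ZpExtension ℚ 2) (γ : Field.absoluteGaloisGroup ℚ), κ.IsCyclotomic →
      κ.IsTopGenerator γ → IsCyclotomicVariable 2 γ →
      ∀ ⦃N : ℕ⦄ [NeZero N] (f : CuspForm (Gamma0 N) 2), IsNewformOf W f →
      ∀ Gp : IwasawaAlgebra 2, iwasawaToPowerSeries 2 Gp = padicLFunction f (unitRoot W 2 : ℚ_[2]) →
      ∀ (D : W.SelmerDualData κ γ) (Yr : W.FineSelmerDualDataRelaxedInf κ γ),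
        lengthAt (IwasawaAlgebra 2) D.X ⟨IwasawaAlgebra.augIdealP 2, IwasawaAlgebra.isPrime_augIdealP_holds 2⟩ ≤
          lengthAt (IwasawaAlgebra 2) (IwasawaAlgebra 2 ⧸ Ideal.span {Gp})
              ⟨IwasawaAlgebra.augIdealP 2, IwasawaAlgebra.isPrime_augIdealP_holds 2⟩ +
            lengthAt (IwasawaAlgebra 2) Yr.X ⟨IwasawaAlgebra.augIdealP 2, IwasawaAlgebra.isPrime_augIdealP_holds 2⟩)
    (hord : IsOrdinaryAt W 2) (ht : ∀ x : ℚ, ¬ HasRationalTwoTorsionX W x) (hΔ : W.Δ < 0) (hr : W.analyticRank = 0) (hbsd : BSDp W 2)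
    {β : AlgebraicClosure ℚ} (hβ : aeval β W.twoTorsionPolynomial.toPoly = 0) {m : ℕ}
    (L : Type) [Field L] [NumberField L] [Algebra ↥(IntermediateField.adjoin ℚ ({β} : Set (AlgebraicClosure ℚ))) L]
    (hL : Module.finrank ↥(IntermediateField.adjoin ℚ ({β} : Set (AlgebraicClosure ℚ))) L = 2 ^ m) (θ : L)
    (hθ : (fun x : L => x ^ 2 - 2)^[m] θ = 0)
    (L' : Type) [Field L'] [NumberField L'] [Algebra ↥(IntermediateField.adjoin ℚ ({β} : Set (AlgebraicClosure ℚ))) L']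
    (hL' : Module.finrank ↥(IntermediateField.adjoin ℚ ({β} : Set (AlgebraicClosure ℚ))) L' = 2 ^ (m + 1)) (θ' : L')
    (hθ' : (fun x : L' => x ^ 2 - 2)^[m + 1] θ' = 0)
    (hclass : padicValNat 2 (Nat.card (ClassGroup (𝓞 L'))) = padicValNat 2 (Nat.card (ClassGroup (𝓞 L)))) :
    MazurMainConjecture W 2 := by
  haveI : FiniteDimensional ℚ ↥(IntermediateField.adjoin ℚ ({β} : Set (AlgebraicClosure ℚ))) :=
    IntermediateField.adjoin.finiteDimensional ((AlgebraicClosure.isAlgebraic ℚ).isAlgebraic β).isIntegral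
  haveI : NumberField ↥(IntermediateField.adjoin ℚ ({β} : Set (AlgebraicClosure ℚ))) := NumberField.mk
  have h3 := finrank_adjoin_eq_three_of_forall_not_hasRationalTwoTorsionX W ht hβ
  exact mazurMainConjecture_two_of_muIneqRel_of_classNumberPExp_succ_eq W h17 hGr hper hmod hGZK hI hord ht hΔ hr
    (AnalyticMuTwo.red_ne_zero_of_isEvenBranchLiftAtTwo_of_forall_not_hasRationalTwoTorsionX W hord ht) hbsd hβ
    fun κP hκP => ⟨m, forall_classNumberPExp_succ_eq_of_layer_models h3 m L hL θ hθ L' hL' θ' hθ' hclass κP hκP⟩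

/-! ## §3 The rung `0` on models, no stratum binder: `L = ℚ(β)`, `L' = ℚ(β)(√2)` -/

/-- **THE RUNG-`0` RANK DOOR ON MODELS, EVERY STRATUM (`Δ_W < 0`).** PRINT⁵ + MuIneqʳ + cell hypotheses + `β` + ANY quadratic extension `L' ⊇ ℚ(β)` with a square
root of `2` (a model of the first layer `ℚ(β)(√2)`) with **`rank₂ Cl(L') = rank₂ Cl(ℚ(β))`** ⟹ `MC₂(W)` — g25's p758570 §2 WITHOUT `Δ_min ≡ 1 (mod 8)` (att-p5 g28:
off the stratum the prime `𝔭₂` of `ℚ(β)` ramifies again in `ℚ(β)(√2)`, so the index is `0` there too). The cheapest certificate shape of the cubic road: class groups of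
ONE cubic and ONE sextic field. CONDITIONAL; nothing closed; BSD is NOT proved. [cite: Fukuda1994, Thm. 1 (2), p. 264] [cite: Washington1997, §13.1]
[cite: Kato2004Asterisque, Thm. 17.4 (1)(2) (p. 273)] [cite: GreenbergLNM1716, Thm. 4.1 (p. 102) and Conj. 1.11 (p. 58)] -/
theorem mazurMainConjecture_two_of_muIneqRel_of_classGroup_rungZero_models
    (h17 : ∀ [NeZero (W.conductorNorm ℤ)] (f : CuspForm (Gamma0 (W.conductorNorm ℤ)) 2),
      kato_divisibility_allPrimes W 2 (f := f))
    (hGr : Greenberg1999.thm41_charValue_rankZero_anyPrime)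
    (hper : realPeriodRat_eq_unit_mul_plusPeriod_two) (hmod : nonempty_modularParametrizationData)
    (hGZK : rank_eq_analyticRank_of_analyticRank_le_one)
    (hI : ∀ (W : WeierstrassCurve ℚ) [W.IsElliptic] [W.IsGloballyMinimal], IsOrdinaryAt W 2 →
      (∀ x : ℚ, ¬ HasRationalTwoTorsionX W x) →
      ∀ (κ : ZpExtension ℚ 2) (γ : Field.absoluteGaloisGroup ℚ), κ.IsCyclotomic →
      κ.IsTopGenerator γ → IsCyclotomicVariable 2 γ →
      ∀ ⦃N : ℕ⦄ [NeZero N] (f : CuspForm (Gamma0 N) 2), IsNewformOf W f →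
      ∀ Gp : IwasawaAlgebra 2, iwasawaToPowerSeries 2 Gp = padicLFunction f (unitRoot W 2 : ℚ_[2]) →
      ∀ (D : W.SelmerDualData κ γ) (Yr : W.FineSelmerDualDataRelaxedInf κ γ),
        lengthAt (IwasawaAlgebra 2) D.X ⟨IwasawaAlgebra.augIdealP 2, IwasawaAlgebra.isPrime_augIdealP_holds 2⟩ ≤
          lengthAt (IwasawaAlgebra 2) (IwasawaAlgebra 2 ⧸ Ideal.span {Gp})
              ⟨IwasawaAlgebra.augIdealP 2, IwasawaAlgebra.isPrime_augIdealP_holds 2⟩ +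
            lengthAt (IwasawaAlgebra 2) Yr.X ⟨IwasawaAlgebra.augIdealP 2, IwasawaAlgebra.isPrime_augIdealP_holds 2⟩)
    (hord : IsOrdinaryAt W 2) (ht : ∀ x : ℚ, ¬ HasRationalTwoTorsionX W x) (hΔ : W.Δ < 0) (hr : W.analyticRank = 0) (hbsd : BSDp W 2)
    {β : AlgebraicClosure ℚ} (hβ : aeval β W.twoTorsionPolynomial.toPoly = 0)
    (L' : Type) [Field L'] [NumberField L'] [Algebra ↥(IntermediateField.adjoin ℚ ({β} : Set (AlgebraicClosure ℚ))) L']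
    (hL' : Module.finrank ↥(IntermediateField.adjoin ℚ ({β} : Set (AlgebraicClosure ℚ))) L' = 2) (θ : L') (hθ : θ ^ 2 = 2)
    (hrank : padicValNat 2 (Nat.card (ClassGroup (𝓞 L') ⧸ (powMonoidHom 2 : ClassGroup (𝓞 L') →* ClassGroup (𝓞 L')).range)) =
      padicValNat 2 (Nat.card (ClassGroup (𝓞 ↥(IntermediateField.adjoin ℚ ({β} : Set (AlgebraicClosure ℚ)))) ⧸
        (powMonoidHom 2 : ClassGroup (𝓞 ↥(IntermediateField.adjoin ℚ ({β} : Set (AlgebraicClosure ℚ)))) →*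
          ClassGroup (𝓞 ↥(IntermediateField.adjoin ℚ ({β} : Set (AlgebraicClosure ℚ))))).range))) :
    MazurMainConjecture W 2 := by
  haveI : FiniteDimensional ℚ ↥(IntermediateField.adjoin ℚ ({β} : Set (AlgebraicClosure ℚ))) :=
    IntermediateField.adjoin.finiteDimensional ((AlgebraicClosure.isAlgebraic ℚ).isAlgebraic β).isIntegral
  haveI : NumberField ↥(IntermediateField.adjoin ℚ ({β} : Set (AlgebraicClosure ℚ))) := NumberField.mk
  have h3 := finrank_adjoin_eq_three_of_forall_not_hasRationalTwoTorsionX W ht hβ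
  exact mazurMainConjecture_two_of_muIneqRel_of_classGroupPRank_succ_eq W h17 hGr hper hmod hGZK hI hord ht hΔ hr
    (AnalyticMuTwo.red_ne_zero_of_isEvenBranchLiftAtTwo_of_forall_not_hasRationalTwoTorsionX W hord ht) hbsd hβ
    fun κP hκP => ⟨0, forall_classGroupPRank_one_eq_zero_of_layerOne_model h3 L' hL' θ hθ hrank κP hκP⟩

/-- **THE RUNG-`0` CLASS-NUMBER DOOR ON MODELS, EVERY STRATUM (`Δ_W < 0`).** The same with **`ord₂ h(L') = ord₂ h(ℚ(β))`** for ANY quadratic extension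
`L' ⊇ ℚ(β)` with a square root of `2`. CONDITIONAL; nothing closed; BSD is NOT proved. [cite: Fukuda1994, Thm. 1 (1), p. 264] [cite: Washington1997, §13.1]
[cite: Kato2004Asterisque, Thm. 17.4 (1)(2) (p. 273)] [cite: GreenbergLNM1716, Thm. 4.1 (p. 102) and Conj. 1.11 (p. 58)] -/
theorem mazurMainConjecture_two_of_muIneqRel_of_classNumber_rungZero_models
    (h17 : ∀ [NeZero (W.conductorNorm ℤ)] (f : CuspForm (Gamma0 (W.conductorNorm ℤ)) 2),
      kato_divisibility_allPrimes W 2 (f := f))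
    (hGr : Greenberg1999.thm41_charValue_rankZero_anyPrime)
    (hper : realPeriodRat_eq_unit_mul_plusPeriod_two) (hmod : nonempty_modularParametrizationData)
    (hGZK : rank_eq_analyticRank_of_analyticRank_le_one)
    (hI : ∀ (W : WeierstrassCurve ℚ) [W.IsElliptic] [W.IsGloballyMinimal], IsOrdinaryAt W 2 →
      (∀ x : ℚ, ¬ HasRationalTwoTorsionX W x) →
      ∀ (κ : ZpExtension ℚ 2) (γ : Field.absoluteGaloisGroup ℚ), κ.IsCyclotomic →
      κ.IsTopGenerator γ → IsCyclotomicVariable 2 γ →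
      ∀ ⦃N : ℕ⦄ [NeZero N] (f : CuspForm (Gamma0 N) 2), IsNewformOf W f →
      ∀ Gp : IwasawaAlgebra 2, iwasawaToPowerSeries 2 Gp = padicLFunction f (unitRoot W 2 : ℚ_[2]) →
      ∀ (D : W.SelmerDualData κ γ) (Yr : W.FineSelmerDualDataRelaxedInf κ γ),
        lengthAt (IwasawaAlgebra 2) D.X ⟨IwasawaAlgebra.augIdealP 2, IwasawaAlgebra.isPrime_augIdealP_holds 2⟩ ≤
          lengthAt (IwasawaAlgebra 2) (IwasawaAlgebra 2 ⧸ Ideal.span {Gp})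
              ⟨IwasawaAlgebra.augIdealP 2, IwasawaAlgebra.isPrime_augIdealP_holds 2⟩ +
            lengthAt (IwasawaAlgebra 2) Yr.X ⟨IwasawaAlgebra.augIdealP 2, IwasawaAlgebra.isPrime_augIdealP_holds 2⟩)
    (hord : IsOrdinaryAt W 2) (ht : ∀ x : ℚ, ¬ HasRationalTwoTorsionX W x) (hΔ : W.Δ < 0) (hr : W.analyticRank = 0) (hbsd : BSDp W 2)
    {β : AlgebraicClosure ℚ} (hβ : aeval β W.twoTorsionPolynomial.toPoly = 0)
    (L' : Type) [Field L'] [NumberField L'] [Algebra ↥(IntermediateField.adjoin ℚ ({β} : Set (AlgebraicClosure ℚ))) L']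
    (hL' : Module.finrank ↥(IntermediateField.adjoin ℚ ({β} : Set (AlgebraicClosure ℚ))) L' = 2) (θ : L') (hθ : θ ^ 2 = 2)
    (hclass : padicValNat 2 (Nat.card (ClassGroup (𝓞 L'))) =
      padicValNat 2 (Nat.card (ClassGroup (𝓞 ↥(IntermediateField.adjoin ℚ ({β} : Set (AlgebraicClosure ℚ))))))) :
    MazurMainConjecture W 2 := by
  haveI : FiniteDimensional ℚ ↥(IntermediateField.adjoin ℚ ({β} : Set (AlgebraicClosure ℚ))) :=
    IntermediateField.adjoin.finiteDimensional ((AlgebraicClosure.isAlgebraic ℚ).isAlgebraic β).isIntegral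
  haveI : NumberField ↥(IntermediateField.adjoin ℚ ({β} : Set (AlgebraicClosure ℚ))) := NumberField.mk
  have h3 := finrank_adjoin_eq_three_of_forall_not_hasRationalTwoTorsionX W ht hβ
  exact mazurMainConjecture_two_of_muIneqRel_of_classNumberPExp_succ_eq W h17 hGr hper hmod hGZK hI hord ht hΔ hr
    (AnalyticMuTwo.red_ne_zero_of_isEvenBranchLiftAtTwo_of_forall_not_hasRationalTwoTorsionX W hord ht) hbsd hβ
    fun κP hκP => ⟨0, forall_classNumberPExp_one_eq_zero_of_layerOne_model h3 L' hL' θ hθ hclass κP hκP⟩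

end Doors

/-! ## §4 Row `2045b1` (the off-stratum seed) at the rung `0` on models, both currencies -/

/-- **ROW `2045b1` AT THE RUNG `0` ON MODELS, RANK currency** (the off-stratum seed, `Δ_min ≡ 3 (mod 8)` — tree
`AlignedTransportAtTwoOffStratumRow2045b.minimalDiscriminantInt_emod_eight_2045b1`; the cheapest certificate of the cubic road): PRINT⁵ + Creutz–Miller
(`N = 2045 < 5000`) + MuIneqʳ + displayed {`r_an(2045b1) = 0`; ONE quadratic extension `L' ⊇ ℚ(β)` with `θ² = 2` and **`rank₂ Cl(L') = rank₂ Cl(ℚ(β))`**}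
⟹ `MC₂(2045b1)` (`β` any root of `4x³ − 3x² − 21880x − 3450700`, the `2`-division cubic of `[1,−1,0,−5470,−172500]`; `u = 4β − 1` has
`u³ − 3u² − 87520u − 55211200 = 0` up to the tree's normalisation), `hμan`-free. DATA ASK (-data): `rank₂ Cl(ℚ(β))` vs `rank₂ Cl(ℚ(β, √2))`. CONDITIONAL; BSD is
NOT proved. [cite: Fukuda1994, Thm. 1 (2), p. 264] [cite: CreutzMiller2012, Thm. 1.1] [cite: Kato2004Asterisque, Thm. 17.4 (1)(2) (p. 273)] -/
theorem mazurMainConjecture_two_2045b1_of_classGroup_rungZero_models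
    (h17 : ∀ [NeZero (c2045b1.conductorNorm ℤ)] (f : CuspForm (Gamma0 (c2045b1.conductorNorm ℤ)) 2),
      kato_divisibility_allPrimes c2045b1 2 (f := f))
    (hGr : Greenberg1999.thm41_charValue_rankZero_anyPrime)
    (hper : realPeriodRat_eq_unit_mul_plusPeriod_two) (hmod : nonempty_modularParametrizationData)
    (hGZK : rank_eq_analyticRank_of_analyticRank_le_one) (hCM : bsdTriple_of_rank_le_one_of_conductor_lt)
    (hI : ∀ (W : WeierstrassCurve ℚ) [W.IsElliptic] [W.IsGloballyMinimal], IsOrdinaryAt W 2 →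
      (∀ x : ℚ, ¬ HasRationalTwoTorsionX W x) →
      ∀ (κ : ZpExtension ℚ 2) (γ : Field.absoluteGaloisGroup ℚ), κ.IsCyclotomic →
      κ.IsTopGenerator γ → IsCyclotomicVariable 2 γ →
      ∀ ⦃N : ℕ⦄ [NeZero N] (f : CuspForm (Gamma0 N) 2), IsNewformOf W f →
      ∀ Gp : IwasawaAlgebra 2, iwasawaToPowerSeries 2 Gp = padicLFunction f (unitRoot W 2 : ℚ_[2]) →
      ∀ (D : W.SelmerDualData κ γ) (Yr : W.FineSelmerDualDataRelaxedInf κ γ),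
        lengthAt (IwasawaAlgebra 2) D.X ⟨IwasawaAlgebra.augIdealP 2, IwasawaAlgebra.isPrime_augIdealP_holds 2⟩ ≤
          lengthAt (IwasawaAlgebra 2) (IwasawaAlgebra 2 ⧸ Ideal.span {Gp})
              ⟨IwasawaAlgebra.augIdealP 2, IwasawaAlgebra.isPrime_augIdealP_holds 2⟩ +
            lengthAt (IwasawaAlgebra 2) Yr.X ⟨IwasawaAlgebra.augIdealP 2, IwasawaAlgebra.isPrime_augIdealP_holds 2⟩)
    (hr0 : c2045b1.analyticRank = 0)
    {β : AlgebraicClosure ℚ} (hβ : aeval β c2045b1.twoTorsionPolynomial.toPoly = 0)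
    (L' : Type) [Field L'] [NumberField L'] [Algebra ↥(IntermediateField.adjoin ℚ ({β} : Set (AlgebraicClosure ℚ))) L']
    (hL' : Module.finrank ↥(IntermediateField.adjoin ℚ ({β} : Set (AlgebraicClosure ℚ))) L' = 2) (θ : L') (hθ : θ ^ 2 = 2)
    (hrank : padicValNat 2 (Nat.card (ClassGroup (𝓞 L') ⧸ (powMonoidHom 2 : ClassGroup (𝓞 L') →* ClassGroup (𝓞 L')).range)) =
      padicValNat 2 (Nat.card (ClassGroup (𝓞 ↥(IntermediateField.adjoin ℚ ({β} : Set (AlgebraicClosure ℚ)))) ⧸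
        (powMonoidHom 2 : ClassGroup (𝓞 ↥(IntermediateField.adjoin ℚ ({β} : Set (AlgebraicClosure ℚ)))) →*
          ClassGroup (𝓞 ↥(IntermediateField.adjoin ℚ ({β} : Set (AlgebraicClosure ℚ))))).range))) :
    MazurMainConjecture c2045b1 2 :=
  mazurMainConjecture_two_of_muIneqRel_of_classGroup_rungZero_models c2045b1 h17 hGr hper hmod hGZK hI goodOrd_two_2045b1
    not_hasRationalTwoTorsionX_2045b1 Δ_2045b1_neg hr0 (bsdp_two_2045b1_of_creutzMiller hCM hGZK hr0) hβ L' hL' θ hθ hrank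

/-- **ROW `2045b1` AT THE RUNG `0` ON MODELS, CLASS-NUMBER currency**: the same with **`ord₂ h(L') = ord₂ h(ℚ(β))`** for ONE quadratic extension
`L' ⊇ ℚ(β)` with `θ² = 2`. DATA ASK (-data): `h(ℚ(β))` and `h(ℚ(β, √2))` (2-parts). CONDITIONAL; BSD is NOT proved. [cite: Fukuda1994, Thm. 1 (1), p. 264]
[cite: CreutzMiller2012, Thm. 1.1] [cite: Kato2004Asterisque, Thm. 17.4 (1)(2) (p. 273)] -/
theorem mazurMainConjecture_two_2045b1_of_classNumber_rungZero_models
    (h17 : ∀ [NeZero (c2045b1.conductorNorm ℤ)] (f : CuspForm (Gamma0 (c2045b1.conductorNorm ℤ)) 2),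
      kato_divisibility_allPrimes c2045b1 2 (f := f))
    (hGr : Greenberg1999.thm41_charValue_rankZero_anyPrime)
    (hper : realPeriodRat_eq_unit_mul_plusPeriod_two) (hmod : nonempty_modularParametrizationData)
    (hGZK : rank_eq_analyticRank_of_analyticRank_le_one) (hCM : bsdTriple_of_rank_le_one_of_conductor_lt)
    (hI : ∀ (W : WeierstrassCurve ℚ) [W.IsElliptic] [W.IsGloballyMinimal], IsOrdinaryAt W 2 →
      (∀ x : ℚ, ¬ HasRationalTwoTorsionX W x) →
      ∀ (κ : ZpExtension ℚ 2) (γ : Field.absoluteGaloisGroup ℚ), κ.IsCyclotomic →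
      κ.IsTopGenerator γ → IsCyclotomicVariable 2 γ →
      ∀ ⦃N : ℕ⦄ [NeZero N] (f : CuspForm (Gamma0 N) 2), IsNewformOf W f →
      ∀ Gp : IwasawaAlgebra 2, iwasawaToPowerSeries 2 Gp = padicLFunction f (unitRoot W 2 : ℚ_[2]) →
      ∀ (D : W.SelmerDualData κ γ) (Yr : W.FineSelmerDualDataRelaxedInf κ γ),
        lengthAt (IwasawaAlgebra 2) D.X ⟨IwasawaAlgebra.augIdealP 2, IwasawaAlgebra.isPrime_augIdealP_holds 2⟩ ≤
          lengthAt (IwasawaAlgebra 2) (IwasawaAlgebra 2 ⧸ Ideal.span {Gp})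
              ⟨IwasawaAlgebra.augIdealP 2, IwasawaAlgebra.isPrime_augIdealP_holds 2⟩ +
            lengthAt (IwasawaAlgebra 2) Yr.X ⟨IwasawaAlgebra.augIdealP 2, IwasawaAlgebra.isPrime_augIdealP_holds 2⟩)
    (hr0 : c2045b1.analyticRank = 0)
    {β : AlgebraicClosure ℚ} (hβ : aeval β c2045b1.twoTorsionPolynomial.toPoly = 0)
    (L' : Type) [Field L'] [NumberField L'] [Algebra ↥(IntermediateField.adjoin ℚ ({β} : Set (AlgebraicClosure ℚ))) L']
    (hL' : Module.finrank ↥(IntermediateField.adjoin ℚ ({β} : Set (AlgebraicClosure ℚ))) L' = 2) (θ : L') (hθ : θ ^ 2 = 2)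
    (hclass : padicValNat 2 (Nat.card (ClassGroup (𝓞 L'))) =
      padicValNat 2 (Nat.card (ClassGroup (𝓞 ↥(IntermediateField.adjoin ℚ ({β} : Set (AlgebraicClosure ℚ))))))) :
    MazurMainConjecture c2045b1 2 :=
  mazurMainConjecture_two_of_muIneqRel_of_classNumber_rungZero_models c2045b1 h17 hGr hper hmod hGZK hI goodOrd_two_2045b1
    not_hasRationalTwoTorsionX_2045b1 Δ_2045b1_neg hr0 (bsdp_two_2045b1_of_creutzMiller hCM hGZK hr0) hβ L' hL' θ hθ hclass

end Summit.BirchSwinnertonDyer.BirchSwinnertonDyer.Theorems.AlignedTransportAtTwoCubicRankDoorModelsAnyRung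

end
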